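import Summits.NavierStokesRegularity.FunctionalMining.StrainFlat
import HarnessLib

/-!
# FunctionalMining — the top Rayleigh value `λ(A) = sup_{|e|=1} eᵀAe` of a flattened tensor

Search for candidate a priori estimates; no regularity claim. Cell `pub-nsfunc`, prove seat
(gen 16). Infrastructure toward the K0 rows `ES.lam1.q|T_C|C1` / `ES.neglam3.q|T_C|C1`
(`TopEigMomentRateSupBound`, `NegBotEigMomentRateSupBound` of `StrainEigen.lean`): the located gap of
DERIVATIVES §29 is a balance law for the NON-SMOOTH convex spectral weight `S ↦ λ₁(S)^q`. The route
taken here is variational: on the flattened tensors `A : EuclideanSpace ℝ (d × d)` (the carrier of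
`StrainL4.strainFlat`) we define the TOP RAYLEIGH VALUE

`TopEig.lam A := sup { ∑ᵢⱼ eᵢ A(i,j) eⱼ : e ⬝ᵥ e = 1 }`,

which for a symmetric `A` is the largest eigenvalue (file `TopEigRayleighSpectral`), and record the
three structural facts the rate rows need and that the eigenvalue API does not give directly:

* `TopEig.convexOn_lam` — `λ` is CONVEX on all of `ℝ^{d×d}` (a supremum of linear forms);
* `TopEig.lipschitzWith_lam` — `λ` is `1`-LIPSCHITZ for the Frobenius (= Euclidean) norm
  (`|eᵀ(A − B)e| ≤ ‖A − B‖` for unit `e`, Cauchy–Schwarz);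
* `TopEig.quad_le_lam_mul`, `TopEig.apply_diag_le_lam`, `TopEig.lam_nonneg_of_sum_diag_eq_zero` —
  Rayleigh bounds (`eᵀAe ≤ λ(A)·eᵀe`, `A(i,i) ≤ λ(A)`, `λ ≥ 0` on trace-free tensors).

Everything is elementary and dimension-free (`d` a nonempty finite type). [ours; folklore linear
algebra — Horn–Johnson 2013 Thm. 4.2.2 (Rayleigh) is the eigenvalue reading, proved in the tree as
`Literature.Analysis.Matrix.KyFan.dotProduct_mulVec_le_eigenvalues₀_max_mul`.]
-/

noncomputable section

open Finset Set
open scoped Matrix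

namespace Summit.NavierStokesRegularity.FunctionalMining

namespace TopEig

variable {d : Type*} [Fintype d] [DecidableEq d]

/-! ## 1. The quadratic (Rayleigh) form of a flattened tensor -/

/-- The quadratic form `eᵀ A e = ∑ᵢⱼ eᵢ A(i,j) eⱼ` of a flattened tensor `A ∈ ℝ^{d×d}`. [ours] -/
def quad (A : EuclideanSpace ℝ (d × d)) (e : d → ℝ) : ℝ := ∑ i, ∑ j, e i * A (i, j) * e j

omit [DecidableEq d] in
/-- `quad` is additive in the tensor. [ours] -/
theorem quad_add (A B : EuclideanSpace ℝ (d × d)) (e : d → ℝ) :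
    quad (A + B) e = quad A e + quad B e := by
  simp only [quad, PiLp.add_apply, ← Finset.sum_add_distrib]
  exact sum_congr rfl fun i _ => sum_congr rfl fun j _ => by ring

omit [DecidableEq d] in
/-- `quad` is homogeneous in the tensor. [ours] -/
theorem quad_smul (c : ℝ) (A : EuclideanSpace ℝ (d × d)) (e : d → ℝ) :
    quad (c • A) e = c * quad A e := by
  simp only [quad, PiLp.smul_apply, smul_eq_mul, Finset.mul_sum]
  exact sum_congr rfl fun i _ => sum_congr rfl fun j _ => by ring

omit [DecidableEq d] in
/-- `quad` of a difference. [ours] -/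
theorem quad_sub (A B : EuclideanSpace ℝ (d × d)) (e : d → ℝ) :
    quad (A - B) e = quad A e - quad B e := by
  rw [sub_eq_add_neg, quad_add, ← neg_one_smul ℝ B, quad_smul]; ring

omit [DecidableEq d] in
/-- `quad` is `2`-homogeneous in the vector. [ours] -/
theorem quad_smul_vec (A : EuclideanSpace ℝ (d × d)) (c : ℝ) (e : d → ℝ) :
    quad A (c • e) = c ^ 2 * quad A e := by
  simp only [quad, Pi.smul_apply, smul_eq_mul, Finset.mul_sum]
  exact sum_congr rfl fun i _ => sum_congr rfl fun j _ => by ring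

omit [DecidableEq d] in
/-- `e ⬝ᵥ e ≥ 0`. [folklore] -/
theorem dotProduct_self_nonneg' (e : d → ℝ) : 0 ≤ e ⬝ᵥ e :=
  sum_nonneg fun _ _ => mul_self_nonneg _

omit [DecidableEq d] in
/-- **Cauchy–Schwarz for the quadratic form**: `|eᵀAe| ≤ ‖A‖ · eᵀe` (Frobenius norm). [folklore] -/
theorem abs_quad_le (A : EuclideanSpace ℝ (d × d)) (e : d → ℝ) :
    |quad A e| ≤ ‖A‖ * (e ⬝ᵥ e) := by
  have hquad : quad A e = ∑ p : d × d, A p * (e p.1 * e p.2) := by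
    rw [quad, Fintype.sum_prod_type]
    exact sum_congr rfl fun i _ => sum_congr rfl fun j _ => by ring
  have hCS := Finset.sum_mul_sq_le_sq_mul_sq (univ : Finset (d × d)) (fun p => A p)
    (fun p => e p.1 * e p.2)
  have hA : ∑ p : d × d, A p ^ 2 = ‖A‖ ^ 2 := (EuclideanCoord.norm_sq_eq_sum_sq A).symm
  have hc : ∑ p : d × d, (e p.1 * e p.2) ^ 2 = (e ⬝ᵥ e) ^ 2 := by
    rw [Fintype.sum_prod_type, dotProduct, sq, Finset.sum_mul_sum]
    exact sum_congr rfl fun i _ => sum_congr rfl fun j _ => by ring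
  rw [hA, hc, ← hquad, ← mul_pow] at hCS
  exact abs_le_of_sq_le_sq hCS (mul_nonneg (norm_nonneg _) (dotProduct_self_nonneg' e))

omit [DecidableEq d] in
/-- For a unit vector, `eᵀAe ≤ ‖A‖`. [folklore] -/
theorem quad_le_norm (A : EuclideanSpace ℝ (d × d)) {e : d → ℝ} (he : e ⬝ᵥ e = 1) :
    quad A e ≤ ‖A‖ := by
  have h := abs_quad_le A e
  rw [he, mul_one] at h
  exact (le_abs_self _).trans h

/-! ## 2. The top Rayleigh value -/

/-- The unit sphere `{e : eᵀe = 1}` of `ℝ^d` (dot-product form). [ours, bookkeeping] -/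
def unitSphere (d : Type*) [Fintype d] : Set (d → ℝ) := {e | e ⬝ᵥ e = 1}

/-- **The top Rayleigh value** `λ(A) = sup {eᵀAe : eᵀe = 1}` of a flattened tensor; for symmetric
`A` this is the largest eigenvalue (`TopEigRayleighSpectral`). Junk (`sSup ∅`) if `d` is empty.
[ours] -/
def lam (A : EuclideanSpace ℝ (d × d)) : ℝ := sSup (quad A '' unitSphere d)

/-- The coordinate vector `eᵢ` is a unit vector. [folklore] -/
theorem single_mem_unitSphere (i : d) : (Pi.single i (1 : ℝ) : d → ℝ) ∈ unitSphere d := by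
  show Pi.single i (1 : ℝ) ⬝ᵥ Pi.single i 1 = 1
  simp

/-- The unit sphere is nonempty when `d` is. [folklore] -/
theorem unitSphere_nonempty [Nonempty d] : (unitSphere d).Nonempty :=
  let ⟨i⟩ := ‹Nonempty d›
  ⟨_, single_mem_unitSphere i⟩

omit [DecidableEq d] in
/-- The Rayleigh values over the unit sphere are bounded above by `‖A‖`. [folklore] -/
theorem bddAbove_quad_image (A : EuclideanSpace ℝ (d × d)) : BddAbove (quad A '' unitSphere d) :=
  ⟨‖A‖, by rintro _ ⟨e, he, rfl⟩; exact quad_le_norm A he⟩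

omit [DecidableEq d] in
/-- Every unit-vector Rayleigh value is at most `λ(A)`. [folklore] -/
theorem quad_le_lam (A : EuclideanSpace ℝ (d × d)) {e : d → ℝ} (he : e ⬝ᵥ e = 1) :
    quad A e ≤ lam A :=
  le_csSup (bddAbove_quad_image A) ⟨e, he, rfl⟩

/-- `λ(A)` is the least upper bound: a uniform bound on unit-vector Rayleigh values bounds `λ(A)`.
[folklore] -/
theorem lam_le [Nonempty d] {A : EuclideanSpace ℝ (d × d)} {c : ℝ}
    (h : ∀ e : d → ℝ, e ⬝ᵥ e = 1 → quad A e ≤ c) : lam A ≤ c :=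
  csSup_le (unitSphere_nonempty.image _) (by rintro _ ⟨e, he, rfl⟩; exact h e he)

/-- `λ(A) ≤ ‖A‖`. [folklore] -/
theorem lam_le_norm [Nonempty d] (A : EuclideanSpace ℝ (d × d)) : lam A ≤ ‖A‖ :=
  lam_le fun _ he => quad_le_norm A he

/-- `−‖A‖ ≤ λ(A)`. [folklore] -/
theorem neg_norm_le_lam [Nonempty d] (A : EuclideanSpace ℝ (d × d)) : -‖A‖ ≤ lam A := by
  obtain ⟨i⟩ := ‹Nonempty d›
  have he := single_mem_unitSphere (d := d) i
  have h := abs_quad_le A (Pi.single i 1)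
  rw [show (Pi.single i (1 : ℝ) : d → ℝ) ⬝ᵥ Pi.single i 1 = 1 from he, mul_one] at h
  exact (neg_le_of_abs_le h).trans (quad_le_lam A he)

/-- `|λ(A)| ≤ ‖A‖`. [folklore] -/
theorem abs_lam_le_norm [Nonempty d] (A : EuclideanSpace ℝ (d × d)) : |lam A| ≤ ‖A‖ :=
  abs_le.2 ⟨neg_norm_le_lam A, lam_le_norm A⟩

/-! ## 3. Convexity and the Lipschitz bound -/

/-- Subadditivity: `λ(A + B) ≤ λ(A) + λ(B)`. [folklore] -/
theorem lam_add_le [Nonempty d] (A B : EuclideanSpace ℝ (d × d)) : lam (A + B) ≤ lam A + lam B :=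
  lam_le fun e he => by rw [quad_add]; exact add_le_add (quad_le_lam A he) (quad_le_lam B he)

/-- Positive homogeneity (upper half): `λ(cA) ≤ c λ(A)` for `c ≥ 0`. [folklore] -/
theorem lam_smul_le [Nonempty d] {c : ℝ} (hc : 0 ≤ c) (A : EuclideanSpace ℝ (d × d)) :
    lam (c • A) ≤ c * lam A :=
  lam_le fun e he => by rw [quad_smul]; exact mul_le_mul_of_nonneg_left (quad_le_lam A he) hc

/-- **`λ` is convex on `ℝ^{d×d}`** (a supremum of the linear forms `A ↦ eᵀAe`). [folklore] -/
theorem convexOn_lam [Nonempty d] : ConvexOn ℝ univ (lam : EuclideanSpace ℝ (d × d) → ℝ) := by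
  refine ⟨convex_univ, fun A _ B _ a b ha hb _ => ?_⟩
  calc lam (a • A + b • B) ≤ lam (a • A) + lam (b • B) := lam_add_le _ _
    _ ≤ a * lam A + b * lam B := add_le_add (lam_smul_le ha A) (lam_smul_le hb B)
    _ = a • lam A + b • lam B := by simp only [smul_eq_mul]

/-- `λ(A) ≤ λ(B) + ‖A − B‖`. [folklore] -/
theorem lam_le_lam_add_norm_sub [Nonempty d] (A B : EuclideanSpace ℝ (d × d)) :
    lam A ≤ lam B + ‖A - B‖ :=
  lam_le fun e he => by
    have h1 : quad A e = quad B e + quad (A - B) e := by rw [quad_sub]; ring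
    rw [h1]
    exact add_le_add (quad_le_lam B he) (quad_le_norm (A - B) he)

/-- **`λ` is `1`-Lipschitz for the Frobenius norm.** [folklore] -/
theorem lipschitzWith_lam [Nonempty d] : LipschitzWith 1 (lam : EuclideanSpace ℝ (d × d) → ℝ) :=
  LipschitzWith.of_le_add fun A B => by
    rw [dist_eq_norm]; exact lam_le_lam_add_norm_sub A B

/-- `|λ(A) − λ(B)| ≤ ‖A − B‖`. [folklore] -/
theorem abs_lam_sub_lam_le [Nonempty d] (A B : EuclideanSpace ℝ (d × d)) :
    |lam A - lam B| ≤ ‖A - B‖ := by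
  rw [abs_sub_le_iff]
  constructor
  · linarith [lam_le_lam_add_norm_sub A B]
  · linarith [lam_le_lam_add_norm_sub B A, norm_sub_rev A B]

/-- `λ` is continuous. [folklore] -/
theorem continuous_lam [Nonempty d] : Continuous (lam : EuclideanSpace ℝ (d × d) → ℝ) :=
  lipschitzWith_lam.continuous

/-! ## 4. Rayleigh bounds: arbitrary vectors, diagonal entries, trace-free tensors -/

omit [DecidableEq d] in
/-- **Rayleigh bound for every vector**: `eᵀAe ≤ λ(A) · eᵀe`. [folklore] -/
theorem quad_le_lam_mul (A : EuclideanSpace ℝ (d × d)) (e : d → ℝ) :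
    quad A e ≤ lam A * (e ⬝ᵥ e) := by
  by_cases he : e ⬝ᵥ e = 0
  · have h := abs_quad_le A e
    rw [he, mul_zero] at h ⊢
    exact (le_abs_self _).trans h
  have hpos : 0 < e ⬝ᵥ e := lt_of_le_of_ne (dotProduct_self_nonneg' e) (Ne.symm he)
  set c : ℝ := Real.sqrt (e ⬝ᵥ e) with hc
  have hcpos : 0 < c := Real.sqrt_pos.mpr hpos
  have hcc : c * c = e ⬝ᵥ e := Real.mul_self_sqrt hpos.le
  have hunit : (c⁻¹ • e) ⬝ᵥ (c⁻¹ • e) = 1 := by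
    rw [smul_dotProduct, dotProduct_smul, smul_eq_mul, smul_eq_mul, ← hcc]
    field_simp
  have h := quad_le_lam A hunit
  rw [quad_smul_vec] at h
  have hc2 : c⁻¹ ^ 2 * (e ⬝ᵥ e) = 1 := by rw [← hcc]; field_simp
  calc quad A e = (c⁻¹ ^ 2 * (e ⬝ᵥ e)) * quad A e := by rw [hc2, one_mul]
    _ = (c⁻¹ ^ 2 * quad A e) * (e ⬝ᵥ e) := by ring
    _ ≤ lam A * (e ⬝ᵥ e) := mul_le_mul_of_nonneg_right h hpos.le

/-- `eᵢᵀ A eᵢ = A(i,i)`. [folklore] -/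
theorem quad_single (A : EuclideanSpace ℝ (d × d)) (i : d) :
    quad A (Pi.single i 1) = A (i, i) := by
  unfold quad
  rw [Finset.sum_eq_single i, Finset.sum_eq_single i]
  · simp
  · intro j _ hj; simp [Pi.single_eq_of_ne hj]
  · intro h; exact absurd (Finset.mem_univ i) h
  · intro j _ hj; simp [Pi.single_eq_of_ne hj]
  · intro h; exact absurd (Finset.mem_univ i) h

/-- **Diagonal entries are below `λ`**: `A(i,i) ≤ λ(A)`. [folklore] -/
theorem apply_diag_le_lam (A : EuclideanSpace ℝ (d × d)) (i : d) : A (i, i) ≤ lam A := by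
  rw [← quad_single A i]
  exact quad_le_lam A (single_mem_unitSphere i)

/-- **`λ ≥ 0` on trace-free tensors** (`∑ᵢ A(i,i) = 0`, `d` nonempty). [folklore] -/
theorem lam_nonneg_of_sum_diag_eq_zero [Nonempty d] (A : EuclideanSpace ℝ (d × d))
    (htr : ∑ i, A (i, i) = 0) : 0 ≤ lam A := by
  by_contra h
  push Not at h
  have hlt : ∀ i, A (i, i) < 0 := fun i => (apply_diag_le_lam A i).trans_lt h
  have : ∑ i, A (i, i) < 0 := by
    obtain ⟨i⟩ := ‹Nonempty d›
    calc ∑ j, A (j, j) < ∑ _j : d, (0 : ℝ) :=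
          Finset.sum_lt_sum (fun j _ => (hlt j).le) ⟨i, Finset.mem_univ _, hlt i⟩
      _ = 0 := by simp
  linarith

/-- The pair Rayleigh values: for `i ≠ j`, `(eᵢ ± eⱼ)ᵀ A (eᵢ ± eⱼ) = A(i,i) + A(j,j) ± (A(i,j) + A(j,i))`
and `(eᵢ ± eⱼ)ᵀ(eᵢ ± eⱼ) = 2`, whence `±(A(i,j) + A(j,i)) ≤ 2λ(A) − A(i,i) − A(j,j)`. [folklore] -/
theorem offdiag_le_lam (A : EuclideanSpace ℝ (d × d)) {i j : d} (hij : i ≠ j) (σ : ℝ)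
    (hσ : σ = 1 ∨ σ = -1) :
    σ * (A (i, j) + A (j, i)) ≤ 2 * lam A - A (i, i) - A (j, j) := by
  set e : d → ℝ := Pi.single i 1 + σ • Pi.single j 1 with he
  have hσ2 : σ * σ = 1 := by rcases hσ with h | h <;> subst h <;> norm_num
  have hei : e i = 1 := by simp [he, Pi.single_eq_of_ne hij]
  have hej : e j = σ := by simp [he, Pi.single_eq_of_ne (Ne.symm hij)]
  have hek : ∀ k, k ≠ i → k ≠ j → e k = 0 := fun k hki hkj => by
    simp [he, Pi.single_eq_of_ne hki, Pi.single_eq_of_ne hkj]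
  -- reduce every sum over `d` to the two indices `i, j`
  have hsum : ∀ f : d → ℝ, (∀ k, k ≠ i → k ≠ j → f k = 0) → ∑ k, f k = f i + f j := by
    intro f hf
    rw [← Finset.sum_subset (Finset.subset_univ ({i, j} : Finset d))
      (fun k _ hk => hf k (by simpa using fun h => hk (by simp [h]))
        (by simpa using fun h => hk (by simp [h]))),
      Finset.sum_pair hij]
  have hee : e ⬝ᵥ e = 2 := by
    rw [dotProduct, hsum _ (fun k hki hkj => by rw [hek k hki hkj, mul_zero]), hei, hej]
    nlinarith [hσ2]
  have hq : quad A e = A (i, i) + A (j, j) + σ * (A (i, j) + A (j, i)) := by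
    unfold quad
    rw [hsum _ (fun k hki hkj => by simp [hek k hki hkj])]
    rw [hsum _ (fun k hki hkj => by simp [hek k hki hkj]),
      hsum _ (fun k hki hkj => by simp [hek k hki hkj]), hei, hej]
    have : σ * A (j, j) * σ = A (j, j) := by
      calc σ * A (j, j) * σ = σ * σ * A (j, j) := by ring
        _ = A (j, j) := by rw [hσ2, one_mul]
    rw [this]; ring
  have h := quad_le_lam_mul A e
  rw [hq, hee] at h
  linarith

end TopEig

end Summit.NavierStokesRegularity.FunctionalMining

end
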